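import Mathlib
import Summits.AtomisticToContinuum.Crystallization.Theorems.GappedShellCensusFiveFoldRationingRStubFfrTwoPoles
import Summits.AtomisticToContinuum.Crystallization.Theorems.GappedShellCensusFiveFoldRationingRStubFfrGreedyFan
import Summits.AtomisticToContinuum.Crystallization.Theorems.GappedShellCensusFiveFoldRationingRStubFfrGreedyCore

/-!
# Crux `GappedShellCensus.FiveFoldRationingR` (stmt-AtomisticToContinuum-18071), line `Sketch` —
# helper for stub `stub_ffrGreedy` (registered sub-goal `stub_ffrSpread`): the directional spread

In an all-gapped-twelve configuration `Y` at scale `a` whose shells have the cuboctahedral, the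
anticuboctahedral or the bicapped-pentagonal-prism bond graph, EVERY SITE HAS A BOND PARTNER IN EVERY
DIRECTION: for `u ∈ Y` and a unit vector `d` some bond partner `w` of `u` has
`⟪w − u, d⟫ ≥ (14/25) a`.

## Proof

Rescale the shell of `u` to a gapped twelve-tuple `t` (`ffrS_rescale`); its bond graph is the
explicit graph `G` of the link type, so all shell-degrees are `≥ 4` and the labelled fan
triangulation `tri` of the radial projection `p k = t k/‖t k‖` is available (`stub_ffrGreedyFan`),
together with its covering property: `d = α p a + β p b + γ p c` with `α, β, γ ≥ 0` for some triple
`{a, b, c} ∈ tri`.  By the combinatorial core (`stub_ffrGreedyCore`, whose counting hypothesis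
`40 + #triangles ≤ #ordered bonds` holds for the three graphs by `decide`) every non-bonded side
`{p, r}` of a triple is the diagonal of a quad `p ~ q ~ r ~ s ~ p` with `q ≁ s`; Euler's
quadrilateral inequality `|t p − t r|² + |t q − t s|² ≤ Σ sides²` (`ffrS_euler_quad`) and
`|t q − t s| ≥ 1.26` give `|t p − t r|² ≤ 2.574`, i.e. `⟪p p, p r⟫ ≥ −1633/4802` (`ffrS_far_inner`),
while bonded sides have cosine `≥ 2201/4802`.  On such a triangle of directions the Gram form is
`≥ (3169/9604) (α + β + γ)²` (`ffrS_gram`: minimum at the midpoint of the far side), whence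
`max ⟪p j, d⟫ ≥ 4/7`, and `⟪t j, d⟫ = ‖t j‖ ⟪p j, d⟫ ≥ (49/50)(4/7) = 14/25`.
-/

noncomputable section

namespace Summit.AtomisticToContinuum.Crystallization.Theorems

open scoped RealInnerProductSpace

/-- **Euler's quadrilateral inequality**: for any four points the sum of the squared diagonals is at
most the sum of the squared sides (the defect is `|p − q + r − s|²`). [folklore] -/
theorem ffrS_euler_quad (p q r s : EuclideanSpace ℝ (Fin 3)) :
    dist p r ^ 2 + dist q s ^ 2 ≤ dist p q ^ 2 + dist q r ^ 2 + dist p s ^ 2 + dist s r ^ 2 := by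
  have e1 : p - r = (p - q) + (q - r) := by abel
  have e2 : q - s = (q - r) + (r - s) := by abel
  have e3 : p - s = (p - q) + (q - r) + (r - s) := by abel
  have e4 : s - r = -(r - s) := by abel
  simp only [dist_eq_norm]
  rw [e1, e2, e3, e4, norm_neg]
  have h1 := norm_add_sq_real (p - q) (q - r)
  have h2 := norm_add_sq_real (q - r) (r - s)
  have h3 := norm_add_sq_real ((p - q) + (q - r)) (r - s)
  have h4 := norm_add_sq_real (p - q) (r - s)
  rw [inner_add_left] at h3
  nlinarith [sq_nonneg ‖(p - q) + (r - s)‖]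

/-- Two shell points (norms in `[0.98, 1.02]`) at squared distance `≤ 6435/2500 = 2.574` subtend an
angle with cosine `≥ −1633/4802 ≈ −0.34` (the value for radii `0.98, 0.98`). [folklore] -/
theorem ffrS_far_inner {a c : EuclideanSpace ℝ (Fin 3)}
    (ha : 1 - 1 / 50 ≤ ‖a‖ ∧ ‖a‖ ≤ 1 + 1 / 50) (hc : 1 - 1 / 50 ≤ ‖c‖ ∧ ‖c‖ ≤ 1 + 1 / 50)
    (hD : dist a c ^ 2 ≤ 6435 / 2500) : -1633 / 4802 ≤ ⟪‖a‖⁻¹ • a, ‖c‖⁻¹ • c⟫ := by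
  have ha0 : 0 < ‖a‖ := by linarith [ha.1]
  have hc0 : 0 < ‖c‖ := by linarith [hc.1]
  rw [ffrC5_inner_normalize a c ha0 hc0, le_div_iff₀ (mul_pos ha0 hc0)]
  have h := norm_sub_sq_real a c
  rw [← dist_eq_norm] at h
  nlinarith [mul_nonneg (sub_nonneg.2 ha.1) (sub_nonneg.2 hc.1), sub_nonneg.2 ha.1,
    sub_nonneg.2 hc.1]

/-- **The Gram form on a fan triangle of directions.**  For unit vectors `p, q, r` with
`⟪p, q⟫, ⟪q, r⟫ ≥ 2201/4802` and `⟪p, r⟫ ≥ −1633/4802`, a unit vector `d = α p + β q + γ r` with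
`α, β, γ ≥ 0` has `⟪p, d⟫`, `⟪q, d⟫` or `⟪r, d⟫ ≥ 4/7`: indeed `1 = ⟪d, d⟫ ≤ (4/7)(α + β + γ)`
would force `α + β + γ ≥ 7/4`, while `1 = ‖d‖² ≥ (3169/9604)(α + β + γ)² > (16/49)(α + β + γ)²`.
[folklore] -/
theorem ffrS_gram {p q r d : EuclideanSpace ℝ (Fin 3)} {α β γ : ℝ} (hp : ‖p‖ = 1) (hq : ‖q‖ = 1)
    (hr : ‖r‖ = 1) (hpq : 2201 / 4802 ≤ ⟪p, q⟫) (hqr : 2201 / 4802 ≤ ⟪q, r⟫)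
    (hpr : -1633 / 4802 ≤ ⟪p, r⟫) (hα : 0 ≤ α) (hβ : 0 ≤ β) (hγ : 0 ≤ γ)
    (hd : d = α • p + β • q + γ • r) (hd1 : ‖d‖ = 1) :
    4 / 7 ≤ ⟪p, d⟫ ∨ 4 / 7 ≤ ⟪q, d⟫ ∨ 4 / 7 ≤ ⟪r, d⟫ := by
  by_contra hcon
  push Not at hcon
  obtain ⟨h1, h2, h3⟩ := hcon
  have hpp : ⟪p, p⟫ = 1 := by rw [real_inner_self_eq_norm_sq, hp, one_pow]
  have hqq : ⟪q, q⟫ = 1 := by rw [real_inner_self_eq_norm_sq, hq, one_pow]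
  have hrr : ⟪r, r⟫ = 1 := by rw [real_inner_self_eq_norm_sq, hr, one_pow]
  have hdd : ⟪d, d⟫ = 1 := by rw [real_inner_self_eq_norm_sq, hd1, one_pow]
  have e1 : ⟪α • p + β • q + γ • r, d⟫ = α * ⟪p, d⟫ + β * ⟪q, d⟫ + γ * ⟪r, d⟫ := by
    rw [inner_add_left, inner_add_left, real_inner_smul_left, real_inner_smul_left,
      real_inner_smul_left]
  rw [← hd, hdd] at e1
  have e2 : ⟪α • p + β • q + γ • r, α • p + β • q + γ • r⟫ = α ^ 2 + β ^ 2 + γ ^ 2 +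
      2 * α * β * ⟪p, q⟫ + 2 * β * γ * ⟪q, r⟫ + 2 * α * γ * ⟪p, r⟫ := by
    simp only [inner_add_left, inner_add_right, real_inner_smul_left, real_inner_smul_right, hpp,
      hqq, hrr, real_inner_comm p q, real_inner_comm p r, real_inner_comm q r]
    ring
  rw [← hd, hdd] at e2
  have hs : 7 / 4 ≤ α + β + γ := by
    nlinarith [mul_le_mul_of_nonneg_left h1.le hα, mul_le_mul_of_nonneg_left h2.le hβ,
      mul_le_mul_of_nonneg_left h3.le hγ]
  have hQ : 3169 / 9604 * (α + β + γ) ^ 2 ≤ 1 := by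
    nlinarith [mul_nonneg (mul_nonneg hα hβ) (sub_nonneg.2 hpq),
      mul_nonneg (mul_nonneg hβ hγ) (sub_nonneg.2 hqr), mul_nonneg (mul_nonneg hα hγ) (sub_nonneg.2 hpr),
      sq_nonneg (α - γ), sq_nonneg β, mul_nonneg hβ (add_nonneg hα hγ)]
  have hs2 : (7 / 4 : ℝ) ^ 2 ≤ (α + β + γ) ^ 2 := pow_le_pow_left₀ (by norm_num) hs 2
  nlinarith

/-- **Rescaling the shell** (the tuple `k ↦ a⁻¹ (w k − y)` of `ffrLG_rescale`, made explicit): norms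
in `[0.98, 1.02]`, pairwise distances `≥ 0.98` and bonded-or-far, and bonds correspond. [folklore] -/
theorem ffrS_rescale {Y : Set (EuclideanSpace ℝ (Fin 3))} {a : ℝ} (ha : 0 < a)
    (hwin : ∀ y ∈ Y, ∀ w ∈ Y, w ≠ y → a * (1 - 1 / 50) ≤ dist y w ∧
      (dist y w ≤ a * (1 + 1 / 50) ∨ a * (63 / 50) ≤ dist y w))
    {y : EuclideanSpace ℝ (Fin 3)} (hy : y ∈ Y) {w : Fin 12 → EuclideanSpace ℝ (Fin 3)}
    (hw : Function.Injective w)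
    (hrange : Set.range w = {u ∈ Y | u ≠ y ∧ dist y u ≤ a * (1 + 1 / 50)}) :
    (∀ k, 1 - 1 / 50 ≤ ‖a⁻¹ • (w k - y)‖ ∧ ‖a⁻¹ • (w k - y)‖ ≤ 1 + 1 / 50) ∧
      (∀ k l, k ≠ l → 1 - 1 / 50 ≤ dist (a⁻¹ • (w k - y)) (a⁻¹ • (w l - y)) ∧
        (dist (a⁻¹ • (w k - y)) (a⁻¹ • (w l - y)) ≤ 1 + 1 / 50 ∨
          63 / 50 ≤ dist (a⁻¹ • (w k - y)) (a⁻¹ • (w l - y)))) ∧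
      (∀ k l, (dist (a⁻¹ • (w k - y)) (a⁻¹ • (w l - y)) ≤ 1 + 1 / 50 ↔
        dist (w k) (w l) ≤ a * (1 + 1 / 50))) := by
  -- adapted from `ffrLG_rescale` (`…StubFfrLinkGlue.lean`), which hides the tuple behind an `∃`
  have hmem : ∀ k, w k ∈ Y ∧ w k ≠ y ∧ dist y (w k) ≤ a * (1 + 1 / 50) := by
    intro k
    have hk : w k ∈ Set.range w := ⟨k, rfl⟩
    rw [hrange] at hk
    exact hk
  have hnorm : ∀ k, ‖a⁻¹ • (w k - y)‖ = dist y (w k) / a := by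
    intro k
    rw [norm_smul, norm_inv, Real.norm_of_nonneg ha.le, ← dist_eq_norm, dist_comm, div_eq_inv_mul]
  have hdist : ∀ k l, dist (a⁻¹ • (w k - y)) (a⁻¹ • (w l - y)) = dist (w k) (w l) / a := by
    intro k l
    rw [dist_smul₀, norm_inv, Real.norm_of_nonneg ha.le, dist_sub_right, div_eq_inv_mul]
  refine ⟨?_, ?_, ?_⟩
  · intro k
    rw [hnorm k, le_div_iff₀ ha, div_le_iff₀ ha]
    obtain ⟨hkY, hky, hyk⟩ := hmem k
    have hlo := (hwin y hy (w k) hkY hky).1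
    constructor <;> linarith
  · intro k l hkl
    rw [hdist k l, le_div_iff₀ ha, div_le_iff₀ ha, le_div_iff₀ ha]
    have hne : w l ≠ w k := fun h => hkl (hw h).symm
    obtain ⟨hlo, hwin'⟩ := hwin (w k) (hmem k).1 (w l) (hmem l).1 hne
    refine ⟨by linarith, ?_⟩
    rcases hwin' with h | h
    · left
      linarith
    · right
      linarith
  · intro k l
    rw [hdist k l, div_le_iff₀ ha, mul_comm]

/-- The cuboctahedron (fcc link): symmetric, irreflexive, `4`-regular, its triangles are among eight
explicit ones, and `40 + 8 ≤ 48 = #ordered bonds`. [folklore] -/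
theorem ffrS_facts_fcc (L : List (ℕ × ℕ))
    (hL : L = [(0, 4), (0, 5), (0, 8), (0, 9), (1, 4), (1, 5), (1, 10), (1, 11), (2, 6), (2, 7),
      (2, 8), (2, 9), (3, 6), (3, 7), (3, 10), (3, 11), (4, 8), (4, 10), (5, 9), (5, 11),
      (6, 8), (6, 10), (7, 9), (7, 11)])
    (G : Fin 12 → Fin 12 → Bool)
    (hG : G = fun k m => decide ((k < m ∧ (k.val, m.val) ∈ L) ∨ (m < k ∧ (m.val, k.val) ∈ L)))
    (TF : Finset (Finset (Fin 12)))
    (hTF : TF = {{0, 4, 8}, {0, 5, 9}, {1, 4, 10}, {1, 5, 11}, {2, 6, 8}, {2, 7, 9}, {3, 6, 10},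
      {3, 7, 11}}) :
    (∀ i j, G i j = G j i) ∧ (∀ k, G k k = false) ∧
      (∀ k, 4 ≤ (Finset.univ.filter fun l => G k l = true).card) ∧
      (∀ a b c : Fin 12, a ≠ b → b ≠ c → a ≠ c → G a b = true → G b c = true → G a c = true →
        ({a, b, c} : Finset (Fin 12)) ∈ TF) ∧
      40 + TF.card ≤ (Finset.univ.filter fun e : Fin 12 × Fin 12 => G e.1 e.2 = true).card := by
  subst hL hG hTF
  refine ⟨by decide, by decide, by decide, by decide, by decide⟩

/-- The anticuboctahedron (hcp link): the same facts. [folklore] -/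
theorem ffrS_facts_hcp (L : List (ℕ × ℕ))
    (hL : L = [(0, 2), (0, 5), (0, 7), (0, 10), (1, 3), (1, 4), (1, 8), (1, 11), (2, 4), (2, 6),
      (2, 9), (3, 5), (3, 8), (3, 11), (4, 6), (4, 9), (5, 7), (5, 10), (6, 7), (6, 8),
      (7, 8), (9, 10), (9, 11), (10, 11)])
    (G : Fin 12 → Fin 12 → Bool)
    (hG : G = fun k m => decide ((k < m ∧ (k.val, m.val) ∈ L) ∨ (m < k ∧ (m.val, k.val) ∈ L)))
    (TF : Finset (Finset (Fin 12)))
    (hTF : TF = {{0, 5, 7}, {0, 5, 10}, {1, 3, 8}, {1, 3, 11}, {2, 4, 6}, {2, 4, 9}, {6, 7, 8},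
      {9, 10, 11}}) :
    (∀ i j, G i j = G j i) ∧ (∀ k, G k k = false) ∧
      (∀ k, 4 ≤ (Finset.univ.filter fun l => G k l = true).card) ∧
      (∀ a b c : Fin 12, a ≠ b → b ≠ c → a ≠ c → G a b = true → G b c = true → G a c = true →
        ({a, b, c} : Finset (Fin 12)) ∈ TF) ∧
      40 + TF.card ≤ (Finset.univ.filter fun e : Fin 12 × Fin 12 => G e.1 e.2 = true).card := by
  subst hL hG hTF
  refine ⟨by decide, by decide, by decide, by decide, by decide⟩

/-- The bicapped pentagonal prism (decahedral axis link): symmetric, irreflexive, degrees `4` and `5`,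
its triangles are among ten explicit ones, and `40 + 10 ≤ 50 = #ordered bonds`. [folklore] -/
theorem ffrS_facts_dec (L : List (ℕ × ℕ))
    (hL : L = [(0, 1), (0, 2), (0, 3), (0, 4), (0, 5), (1, 2), (1, 5), (1, 6), (2, 3), (2, 7), (3, 4),
      (3, 8), (4, 5), (4, 9), (5, 10), (6, 7), (6, 10), (6, 11), (7, 8), (7, 11), (8, 9),
      (8, 11), (9, 10), (9, 11), (10, 11)])
    (G : Fin 12 → Fin 12 → Bool)
    (hG : G = fun k m => decide ((k < m ∧ (k.val, m.val) ∈ L) ∨ (m < k ∧ (m.val, k.val) ∈ L)))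
    (TF : Finset (Finset (Fin 12)))
    (hTF : TF = {{0, 1, 2}, {0, 1, 5}, {0, 2, 3}, {0, 3, 4}, {0, 4, 5}, {6, 7, 11}, {6, 10, 11},
      {7, 8, 11}, {8, 9, 11}, {9, 10, 11}}) :
    (∀ i j, G i j = G j i) ∧ (∀ k, G k k = false) ∧
      (∀ k, 4 ≤ (Finset.univ.filter fun l => G k l = true).card) ∧
      (∀ a b c : Fin 12, a ≠ b → b ≠ c → a ≠ c → G a b = true → G b c = true → G a c = true →
        ({a, b, c} : Finset (Fin 12)) ∈ TF) ∧
      40 + TF.card ≤ (Finset.univ.filter fun e : Fin 12 × Fin 12 => G e.1 e.2 = true).card := by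
  subst hL hG hTF
  refine ⟨by decide, by decide, by decide, by decide, by decide⟩

/-- **Directional spread of a gapped twelve-tuple with an admissible bond graph.**  If the bonds of
`t` are given by a symmetric irreflexive `G` with degrees `≥ 4` and few triangles
(`40 + #TF ≤ #ordered bonds`), then for every unit `d` some direction `t k/‖t k‖` has
`⟪t k/‖t k‖, d⟫ ≥ 4/7`. [folklore] -/
theorem ffrS_spread_tuple (G : Fin 12 → Fin 12 → Bool) (hGs : ∀ i j, G i j = G j i)
    (hirr : ∀ k, G k k = false) (hdeg : ∀ k, 4 ≤ (Finset.univ.filter fun l => G k l = true).card)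
    (TF : Finset (Finset (Fin 12)))
    (hTF : ∀ a b c : Fin 12, a ≠ b → b ≠ c → a ≠ c → G a b = true → G b c = true → G a c = true →
      ({a, b, c} : Finset (Fin 12)) ∈ TF)
    (hcnt : 40 + TF.card ≤ (Finset.univ.filter fun e : Fin 12 × Fin 12 => G e.1 e.2 = true).card)
    (t : Fin 12 → EuclideanSpace ℝ (Fin 3))
    (hn : ∀ k, 1 - 1 / 50 ≤ ‖t k‖ ∧ ‖t k‖ ≤ 1 + 1 / 50)
    (hd : ∀ k l, k ≠ l → 1 - 1 / 50 ≤ dist (t k) (t l) ∧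
      (dist (t k) (t l) ≤ 1 + 1 / 50 ∨ 63 / 50 ≤ dist (t k) (t l)))
    (hG : ∀ k l, k ≠ l → (dist (t k) (t l) ≤ 1 + 1 / 50 ↔ G k l = true))
    (d : EuclideanSpace ℝ (Fin 3)) (hd1 : ‖d‖ = 1) : ∃ k, 4 / 7 ≤ ⟪‖t k‖⁻¹ • t k, d⟫ := by
  -- shell-degrees `≥ 4`
  have h4 : ∀ k, 4 ≤ (Finset.univ.filter fun l => l ≠ k ∧ dist (t k) (t l) ≤ 1 + 1 / 50).card := by
    intro k
    have heq : (Finset.univ.filter fun l => l ≠ k ∧ dist (t k) (t l) ≤ 1 + 1 / 50) =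
        Finset.univ.filter fun l => G k l = true := by
      ext l
      simp only [Finset.mem_filter, Finset.mem_univ, true_and]
      by_cases hlk : l = k
      · subst hlk
        simp [hirr]
      · rw [hG k l (Ne.symm hlk)]
        exact ⟨fun h => h.2, fun h => ⟨hlk, h⟩⟩
    rw [heq]
    exact hdeg k
  -- the labelled fan triangulation with covering
  obtain ⟨u, hu⟩ : ∃ u : Fin 12 → EuclideanSpace ℝ (Fin 3), u = fun k => ‖t k‖⁻¹ • t k := ⟨_, rfl⟩
  obtain ⟨X, hX⟩ : ∃ X : Finset (EuclideanSpace ℝ (Fin 3)), X = Finset.univ.image u := ⟨_, rfl⟩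
  obtain ⟨tri, htri⟩ : ∃ tri : Finset (Finset (Fin 12)), tri = Finset.univ.powerset.filter fun S =>
      S.image u ∈ Literature.Geometry.DiscreteGeometry.fanTriSets X := ⟨_, rfl⟩
  obtain ⟨h3, h20, hside, hbond, htri3, hlink, hcov⟩ := stub_ffrGreedyFan t hn hd h4 u hu X hX tri htri
  clear htri hX
  have hbond' : ∀ v w, v ≠ w → G v w = true →
      (tri.filter fun S' => ({v, w} : Finset (Fin 12)) ⊆ S').card = 2 :=
    fun v w hvw g => hbond v w hvw ((hG v w hvw).2 g)
  have htri3' : ∀ a b c, a ≠ b → b ≠ c → a ≠ c → G a b = true → G b c = true → G a c = true →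
      ({a, b, c} : Finset (Fin 12)) ∈ tri :=
    fun a b c hab hbc hac gab gbc gac =>
      htri3 a b c hab hbc hac ((hG a b hab).2 gab) ((hG b c hbc).2 gbc) ((hG a c hac).2 gac)
  -- cosines: bonds `≥ 2201/4802`, far sides `≥ −1633/4802`
  have hu1 : ∀ k, ‖u k‖ = 1 := fun k => by rw [hu]; exact ffrC5_norm_normalize (hn k)
  have hlo : ∀ k l, k ≠ l → G k l = true → 2201 / 4802 ≤ ⟪u k, u l⟫ := fun k l hkl g => by
    rw [hu]; exact ffrC5_le_inner_normalize (hn k) (hn l) ((hG k l hkl).2 g)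
  have hne_of : ∀ {k l}, G k l = true → k ≠ l := fun {k l} g h => by
    rw [h, hirr] at g
    exact Bool.false_ne_true g
  have hfar : ∀ S ∈ tri, ∀ p ∈ S, ∀ r ∈ S, p ≠ r → G p r = false →
      -1633 / 4802 ≤ ⟪u p, u r⟫ ∧ ∀ q ∈ S, q ≠ p → q ≠ r → G p q = true ∧ G q r = true := by
    intro S hS p hp r hr hpr hGpr
    obtain ⟨q, hq, s, hqs, gpq, gqr, gps, gsr, gqs⟩ := stub_ffrGreedyCore G hGs hirr hdeg TF hTF hcnt
      tri h3 h20 hside hbond' htri3' hlink S hS p r hp hr hpr hGpr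
    have hqp : q ≠ p := (hne_of gpq).symm
    have hqr : q ≠ r := hne_of gqr
    have hsp : s ≠ p := (hne_of gps).symm
    have hsr : s ≠ r := hne_of gsr
    have b1 := pow_le_pow_left₀ dist_nonneg ((hG p q hqp.symm).2 gpq) 2
    have b2 := pow_le_pow_left₀ dist_nonneg ((hG q r hqr).2 gqr) 2
    have b3 := pow_le_pow_left₀ dist_nonneg ((hG p s hsp.symm).2 gps) 2
    have b4 := pow_le_pow_left₀ dist_nonneg ((hG s r hsr).2 gsr) 2
    have dqs : 63 / 50 ≤ dist (t q) (t s) := by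
      rcases (hd q s hqs).2 with h | h
      · have := (hG q s hqs).1 h
        rw [gqs] at this
        exact absurd this Bool.false_ne_true
      · exact h
    have b5 := pow_le_pow_left₀ (by norm_num : (0 : ℝ) ≤ 63 / 50) dqs 2
    have hE := ffrS_euler_quad (t p) (t q) (t r) (t s)
    have hD : dist (t p) (t r) ^ 2 ≤ 6435 / 2500 := by nlinarith
    refine ⟨by rw [hu]; exact ffrS_far_inner (hn p) (hn r) hD, fun q' hq' hq'p hq'r => ?_⟩
    have hSeq := ffrGC_eq_triple (h3 S hS) hp hq hr hqp.symm hqr hpr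
    rw [hSeq] at hq'
    simp only [Finset.mem_insert, Finset.mem_singleton] at hq'
    rcases hq' with h | h | h
    · exact absurd h hq'p
    · subst h
      exact ⟨gpq, gqr⟩
    · exact absurd h hq'r
  -- the covering triple of `d`
  obtain ⟨a, b, c, habc, α, β, γ, hα, hβ, hγ, hdx⟩ := hcov d
  have hS3 := h3 _ habc
  have hab : a ≠ b := by
    rintro rfl
    rw [Finset.insert_eq_of_mem (Finset.mem_insert_self a {c})] at hS3
    have := Finset.card_le_two (a := a) (b := c)
    omega
  have hbc : b ≠ c := by
    rintro rfl
    rw [Finset.insert_eq_of_mem (Finset.mem_singleton_self b)] at hS3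
    have := Finset.card_le_two (a := a) (b := b)
    omega
  have hac : a ≠ c := by
    rintro rfl
    rw [Finset.insert_eq_of_mem (by simp : a ∈ ({b, a} : Finset (Fin 12)))] at hS3
    have := Finset.card_le_two (a := b) (b := a)
    omega
  have key : 4 / 7 ≤ ⟪u a, d⟫ ∨ 4 / 7 ≤ ⟪u b, d⟫ ∨ 4 / 7 ≤ ⟪u c, d⟫ := by
    have weak : ∀ {k l}, k ≠ l → G k l = true → -1633 / 4802 ≤ ⟪u k, u l⟫ :=
      fun hkl g => le_trans (by norm_num) (hlo _ _ hkl g)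
    by_cases gac : G a c = true
    · by_cases gab : G a b = true
      · by_cases gbc : G b c = true
        · exact ffrS_gram (hu1 a) (hu1 b) (hu1 c) (hlo a b hab gab) (hlo b c hbc gbc) (weak hac gac)
            hα hβ hγ hdx hd1
        · -- `b ≁ c`: apex `a`
          have hf := hfar _ habc b (by simp) c (by simp) hbc (by simpa using gbc)
          have h := ffrS_gram (hu1 b) (hu1 a) (hu1 c) (by rw [real_inner_comm]; exact hlo a b hab gab)
            (hlo a c hac gac) hf.1 hβ hα hγ (by rw [hdx, add_comm (α • u a)]) hd1
          tauto
      · -- `a ≁ b`: apex `c`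
        have hf := hfar _ habc a (by simp) b (by simp) hab (by simpa using gab)
        obtain ⟨-, gcb⟩ := hf.2 c (by simp) hac.symm hbc.symm
        have h := ffrS_gram (hu1 a) (hu1 c) (hu1 b) (hlo a c hac gac) (hlo c b hbc.symm gcb) hf.1
          hα hγ hβ (by rw [hdx, add_right_comm]) hd1
        tauto
    · -- `a ≁ c`: apex `b`
      have hf := hfar _ habc a (by simp) c (by simp) hac (by simpa using gac)
      obtain ⟨gab, gbc⟩ := hf.2 b (by simp) hab.symm hbc
      exact ffrS_gram (hu1 a) (hu1 b) (hu1 c) (hlo a b hab gab) (hlo b c hbc gbc) hf.1 hα hβ hγ hdx hd1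
  rw [hu] at key
  rcases key with h | h | h
  · exact ⟨a, h⟩
  · exact ⟨b, h⟩
  · exact ⟨c, h⟩

/-- **Directional spread** (registered sub-goal `stub_ffrSpread` of `stub_ffrGreedy`).  In an
all-gapped-twelve configuration at scale `a` with cuboctahedral / anticuboctahedral / prismatic
shell bond graphs, for every site `u` and every unit vector `d` some bond partner `w ∈ Y` of `u`
(`w ≠ u`, `dist u w ≤ a (1 + 1/50)`) has `⟪w − u, d⟫ ≥ (14/25) a`. [folklore] -/
theorem stub_ffrSpread :
    ∀ (Y : Set (EuclideanSpace ℝ (Fin 3))) (a : ℝ), 0 < a →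
      (∀ y ∈ Y, ({w ∈ Y | w ≠ y ∧ dist y w ≤ a * (1 + 1 / 50)}.ncard = 12 ∧
        ∀ w ∈ Y, w ≠ y → a * (1 - 1 / 50) ≤ dist y w ∧
          (dist y w ≤ a * (1 + 1 / 50) ∨ a * (63 / 50) ≤ dist y w))) →
      (∀ y ∈ Y, ∃ e : Fin 12 → EuclideanSpace ℝ (Fin 3), Function.Injective e ∧
        Set.range e = {w ∈ Y | w ≠ y ∧ dist y w ≤ a * (1 + 1 / 50)} ∧
        ((∀ i j : Fin 12, i < j → (dist (e i) (e j) ≤ a * (1 + 1 / 50) ↔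
            (i.val, j.val) ∈ ([(0, 4), (0, 5), (0, 8), (0, 9), (1, 4), (1, 5), (1, 10), (1, 11), (2, 6), (2, 7),
                (2, 8), (2, 9), (3, 6), (3, 7), (3, 10), (3, 11), (4, 8), (4, 10), (5, 9), (5, 11),
                (6, 8), (6, 10), (7, 9), (7, 11)] : List (ℕ × ℕ)))) ∨
          (∀ i j : Fin 12, i < j → (dist (e i) (e j) ≤ a * (1 + 1 / 50) ↔
            (i.val, j.val) ∈ ([(0, 2), (0, 5), (0, 7), (0, 10), (1, 3), (1, 4), (1, 8), (1, 11), (2, 4), (2, 6),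
                (2, 9), (3, 5), (3, 8), (3, 11), (4, 6), (4, 9), (5, 7), (5, 10), (6, 7), (6, 8),
                (7, 8), (9, 10), (9, 11), (10, 11)] : List (ℕ × ℕ)))) ∨
          (∀ i j : Fin 12, i < j → (dist (e i) (e j) ≤ a * (1 + 1 / 50) ↔
            (i.val, j.val) ∈ ([(0, 1), (0, 2), (0, 3), (0, 4), (0, 5), (1, 2), (1, 5), (1, 6), (2, 3), (2, 7), (3, 4),
                (3, 8), (4, 5), (4, 9), (5, 10), (6, 7), (6, 10), (6, 11), (7, 8), (7, 11), (8, 9),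
                (8, 11), (9, 10), (9, 11), (10, 11)] : List (ℕ × ℕ)))))) →
      ∀ u ∈ Y, ∀ d : EuclideanSpace ℝ (Fin 3), ‖d‖ = 1 →
        ∃ w ∈ Y, w ≠ u ∧ dist u w ≤ a * (1 + 1 / 50) ∧ 14 / 25 * a ≤ inner ℝ (w - u) d := by
  intro Y a ha hgap hL u hu d hd1
  obtain ⟨e, he, hrange, hG3⟩ := hL u hu
  obtain ⟨tn, td, tiff⟩ :=
    ffrS_rescale ha (fun y hy w hw hne => (hgap y hy).2 w hw hne) hu he hrange
  have hmem : ∀ k, e k ∈ Y ∧ e k ≠ u ∧ dist u (e k) ≤ a * (1 + 1 / 50) := fun k => by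
    have hk : e k ∈ Set.range e := ⟨k, rfl⟩
    rw [hrange] at hk
    exact hk
  -- bonds of the rescaled tuple = the explicit graph, in Bool form
  have hGiff : ∀ L : List (ℕ × ℕ),
      (∀ i j : Fin 12, i < j → (dist (e i) (e j) ≤ a * (1 + 1 / 50) ↔ (i.val, j.val) ∈ L)) →
      ∀ k l : Fin 12, k ≠ l → (dist (a⁻¹ • (e k - u)) (a⁻¹ • (e l - u)) ≤ 1 + 1 / 50 ↔
        (fun k m : Fin 12 => decide ((k < m ∧ (k.val, m.val) ∈ L) ∨ (m < k ∧ (m.val, k.val) ∈ L)))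
          k l = true) := by
    intro L hadj k l hkl
    rw [tiff, ffrTP_adj_iff L hadj hkl.symm, decide_eq_true_iff]
  have key : ∃ k, 4 / 7 ≤ ⟪‖a⁻¹ • (e k - u)‖⁻¹ • (a⁻¹ • (e k - u)), d⟫ := by
    rcases hG3 with h | h | h
    · obtain ⟨hs, hi, hdg, hT, hc⟩ := ffrS_facts_fcc _ rfl _ rfl _ rfl
      exact ffrS_spread_tuple _ hs hi hdg _ hT hc _ tn td (hGiff _ h) d hd1
    · obtain ⟨hs, hi, hdg, hT, hc⟩ := ffrS_facts_hcp _ rfl _ rfl _ rfl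
      exact ffrS_spread_tuple _ hs hi hdg _ hT hc _ tn td (hGiff _ h) d hd1
    · obtain ⟨hs, hi, hdg, hT, hc⟩ := ffrS_facts_dec _ rfl _ rfl _ rfl
      exact ffrS_spread_tuple _ hs hi hdg _ hT hc _ tn td (hGiff _ h) d hd1
  obtain ⟨k, hk⟩ := key
  refine ⟨e k, (hmem k).1, (hmem k).2.1, (hmem k).2.2, ?_⟩
  have htk : 1 - 1 / 50 ≤ ‖a⁻¹ • (e k - u)‖ := (tn k).1
  have hpos : 0 < ‖a⁻¹ • (e k - u)‖ := by linarith
  have e1 : ⟪‖a⁻¹ • (e k - u)‖⁻¹ • (a⁻¹ • (e k - u)), d⟫ =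
      ⟪e k - u, d⟫ / (‖a⁻¹ • (e k - u)‖ * a) := by
    rw [real_inner_smul_left, real_inner_smul_left, ← mul_assoc, ← mul_inv, inv_mul_eq_div]
  rw [e1, le_div_iff₀ (mul_pos hpos ha)] at hk
  change 14 / 25 * a ≤ ⟪e k - u, d⟫
  nlinarith [mul_le_mul_of_nonneg_left htk ha.le]

end Summit.AtomisticToContinuum.Crystallization.Theorems

end
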